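import Mathlib
import Summits.CriticalPhenomena.PercolationContinuityZ3.Theorems.PercNearOneGluingNearOneGluingKnLemma3i
import Summits.CriticalPhenomena.PercolationContinuityZ3.Theorems.PercNearOneGluingNearOneGluingMaxattTwo
import Literature.Probability.Percolation.TwoClusterConditionalAssociationProofs
import Summits.CriticalPhenomena.PercolationContinuityZ3.Theorems.PercNearOneGluingAdditiveGluingPocketBHKCov
import Summits.CriticalPhenomena.PercolationContinuityZ3.Theorems.PercNearOneGluingNearOneGluingVariants2455
import Literature.Probability.LatticeModels.ProdBernoulliIndependence
import Literature.Probability.Percolation.Crossings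
import Literature.Probability.Percolation.PercolationEvents
import HarnessLib

/-!
# Crux `PercNearOneGluing.NearOneGluing` (stmt-CriticalPhenomena-4574), line `SketchR2I5` — stub `stub_attachRescueNegCorr`

Helper file for the crux (lead prover-line-stmt-CriticalPhenomena-4574-c4): the provable
negative-correlation piece of the glued-graph reduction of the `|A| = 3` case of the MAXATT /
least-reliable-first gluing inequality.  Proves exactly the registered stub signature; lands with
`--supports stmt-CriticalPhenomena-4574`.

## Content

Finite weighted graph on `Fin n`, `μ = prodBernoulli w` on bond configurations
`ω : Set (Sym2 (Fin n))`, target `b`, source `o`, two relays `y, z`, a vertex set `S`.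
Attachment event `Zt = {o ↔ z inside S}` (increasing, and increasing in the open edge cluster of
`z`) and rescue event `f = {z ↮ b} ∩ {y ↔ b}` ("`z` is dead but its colleague `y` is alive").
THEOREM (`stub_attachRescueNegCorr`): **`μ(Zt ∩ f) ≤ μ(Zt) · μ(f)`.**

Proof.  If `y = z` then `f = ∅`.  Otherwise put `D = {y ↮ z}`; then `f ⊆ D` (if `z ↮ b` and
`y ↔ b` then `y ↮ z`).  van den Berg–Häggström–Kahn (2006), Thm. 1.5
(`BHK2006_twoClusterConditionalAssociation_holds`, proved in the tree) for `s = y`, `t = z`,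
`F(C_y, C_z) = 1{C_y witnesses y ↔ b} · (1 − 1{C_z witnesses z ↔ b})` (increasing in `C_y`,
decreasing in `C_z`) and `G(C_y, C_z) = 1 − 1{C_z witnesses Zt}` (decreasing in `C_z`) reads
`(∫_D F)(∫_D G) ≤ μ(D) ∫_D F G`, i.e. `μ(f) · (μ(D) − μ(D ∩ Zt)) ≤ μ(D) · (μ(f) − μ(f ∩ Zt))`,
i.e. `μ(D) μ(Zt ∩ f) ≤ μ(f) μ(Zt ∩ D)`.  Harris for the increasing `Zt` and the decreasing `D`
(`prodBernoulli_harris_upper_lower`): `μ(Zt ∩ D) ≤ μ(Zt) μ(D)`.  Hence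
`μ(D) μ(Zt ∩ f) ≤ μ(D) μ(Zt) μ(f)`; divide by `μ(D)` (if `μ(D) = 0` then `μ(Zt ∩ f) ≤ μ(f) ≤ μ(D) = 0`).
-/

namespace Summit.CriticalPhenomena.PercolationContinuityZ3.Theorems

open MeasureTheory Set Literature.Probability.LatticeModels Literature.Probability.Percolation
open scoped Classical BigOperators

section AttachRescueNegCorr

universe u

variable {V : Type u} [Fintype V]

/-- **BHK (2006) Thm. 1.5 with `f = 1{s ↔ b} · 1{t ↮ b}`, `g = 1 − 1_Q`** (`Q` increasing and
determined by `C_t`; `f` is increasing in `C_s` and decreasing in `C_t`, `g` is decreasing in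
`C_t`): for `D = {s ↮ t}`,
`μ(D ∩ ({t ↮ b} ∩ {s ↔ b})) · μ(D ∩ Qᶜ) ≤ μ(D) · μ(D ∩ ({t ↮ b} ∩ {s ↔ b} ∩ Qᶜ))`.
[cite: VandenbergHaggstromKahn2005, Thm. 1.5 (p. 7, eq. (9))] -/
theorem attachRescueNegCorr_twoCluster (w : Sym2 V → unitInterval) (s t b : V)
    (Q : Set (BondConfig V))
    (hQ : ∀ ω ω', ω ∈ Q → openEdgeCluster ω t ⊆ openEdgeCluster ω' t → ω' ∈ Q) (hst : s ≠ t) :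
    (prodBernoulli w).real ((openConn s t)ᶜ ∩ ((openConn t b)ᶜ ∩ openConn s b)) *
        (prodBernoulli w).real ((openConn s t)ᶜ ∩ Qᶜ) ≤
      (prodBernoulli w).real (openConn s t)ᶜ *
        (prodBernoulli w).real ((openConn s t)ᶜ ∩ ((openConn t b)ᶜ ∩ openConn s b ∩ Qᶜ)) := by
  have key := BHK2006_twoClusterConditionalAssociation_holds V w s t
    (fun C D => connIndicatorFn s b C * (1 - connIndicatorFn t b D))
    (fun _ D => 1 - {C : Set (Sym2 V) | ∃ ω ∈ Q, openEdgeCluster ω t ⊆ C}.indicator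
      (1 : Set (Sym2 V) → ℝ) D)
    (fun D _ _ h => mul_le_mul_of_nonneg_right (monotone_connIndicatorFn s b h)
      (sub_nonneg.2 (knConj6Two_connIndicatorFn_le_one t b D)))
    (fun C _ _ h => mul_le_mul_of_nonneg_left (sub_le_sub_left (monotone_connIndicatorFn t b h) 1)
      (PocketBHK.connIndicatorFn_nonneg s b C))
    (fun _ => monotone_const)
    (fun _ _ _ h => sub_le_sub_left (knLemma3i_monotone_indicator_upClosure Q t h) 1) hst
  have hD : {ω : BondConfig V | ¬ (openGraph ω).Reachable s t} = (openConn s t)ᶜ := rfl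
  have hm : ∀ E : Set (BondConfig V), MeasurableSet E := fun _ => MeasurableSet.of_discrete
  simp only [connIndicatorFn_openEdgeCluster, knLemma3i_indicator_upClosure_openEdgeCluster hQ,
    hD] at key
  -- pointwise identities of indicators
  have e1 : ∀ ω : BondConfig V, (openConn s b).indicator (1 : BondConfig V → ℝ) ω *
      (1 - (openConn t b).indicator (1 : BondConfig V → ℝ) ω) =
        ((openConn t b)ᶜ ∩ openConn s b).indicator 1 ω := by
    intro ω
    by_cases h1 : ω ∈ openConn s b <;> by_cases h2 : ω ∈ openConn t b <;> simp [h1, h2]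
  have e2 : ∀ ω : BondConfig V, (1 : ℝ) - Q.indicator (1 : BondConfig V → ℝ) ω =
      Qᶜ.indicator 1 ω := by
    intro ω
    by_cases h : ω ∈ Q <;> simp [h]
  have e3 : ∀ ω : BondConfig V, ((openConn t b)ᶜ ∩ openConn s b).indicator (1 : BondConfig V → ℝ) ω
      * Qᶜ.indicator (1 : BondConfig V → ℝ) ω =
        ((openConn t b)ᶜ ∩ openConn s b ∩ Qᶜ).indicator 1 ω :=
    fun ω => (congrFun (Set.inter_indicator_one (s := (openConn t b)ᶜ ∩ openConn s b)
      (t := Qᶜ) (M₀ := ℝ)) ω).symm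
  rw [show (fun ω : BondConfig V => (openConn s b).indicator (1 : BondConfig V → ℝ) ω *
        (1 - (openConn t b).indicator 1 ω)) = ((openConn t b)ᶜ ∩ openConn s b).indicator 1 from
      funext e1,
    show (fun ω : BondConfig V => (1 : ℝ) - Q.indicator (1 : BondConfig V → ℝ) ω) =
        Qᶜ.indicator 1 from funext e2,
    show (fun ω : BondConfig V => (openConn s b).indicator (1 : BondConfig V → ℝ) ω *
        (1 - (openConn t b).indicator 1 ω) * (1 - Q.indicator 1 ω)) =
        ((openConn t b)ᶜ ∩ openConn s b ∩ Qᶜ).indicator 1 from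
      funext fun ω => by rw [e1, e2, e3]] at key
  rw [setIntegral_indicator (hm _), setIntegral_indicator (hm _), setIntegral_indicator (hm _)]
    at key
  simpa only [Pi.one_apply, setIntegral_const, smul_eq_mul, mul_one] using key

end AttachRescueNegCorr

/-- **Attachment is nonpositively correlated with "dead but the colleague alive".**  For the
attachment event `Zt = {o ↔ z inside S}` (any vertex set `S`) and the rescue event
`f = {z ↮ b} ∩ {y ↔ b}`: `μ(Zt ∩ f) ≤ μ(Zt) · μ(f)`.  From van den Berg–Häggström–Kahn (2006)
Thm. 1.5 for the pair `(y, z)` (`attachRescueNegCorr_twoCluster`) and Harris' inequality for an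
increasing and a decreasing event. [cite: VandenbergHaggstromKahn2005, Thm. 1.5 (p. 7)] -/
theorem stub_attachRescueNegCorr :
    ∀ (n : ℕ) (w : Sym2 (Fin n) → unitInterval) (S : Set (Fin n)) (o b y z : Fin n),
      (prodBernoulli w).real (openConnIn S o z ∩ ((openConn z b)ᶜ ∩ openConn y b)) ≤
        (prodBernoulli w).real (openConnIn S o z) * (prodBernoulli w).real ((openConn z b)ᶜ ∩ openConn y b) := by
  intro n w S o b y z
  have hm : ∀ E : Set (BondConfig (Fin n)), MeasurableSet E := fun _ => MeasurableSet.of_discrete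
  rcases eq_or_ne y z with hyz | hyz
  · subst hyz
    rw [Set.compl_inter_self, Set.inter_empty, measureReal_empty]
    exact mul_nonneg measureReal_nonneg le_rfl
  -- BHK Thm. 1.5 for `(y, z)` and Harris for `Zt` (increasing) and `D = {y ↮ z}` (decreasing)
  have key := attachRescueNegCorr_twoCluster w y z b (openConnIn S o z)
    (maxattTwo_openConnIn_mono_openEdgeCluster S o z) hyz
  have hharris : (prodBernoulli w).real (openConnIn S o z ∩ (openConn y z)ᶜ) ≤
      (prodBernoulli w).real (openConnIn S o z) * (prodBernoulli w).real (openConn y z)ᶜ :=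
    prodBernoulli_harris_upper_lower w (isUpperSet_openConnIn S o z)
      (isUpperSet_openConn y z).compl (hm _) (hm _)
  -- notation
  set μ := prodBernoulli w with hμ
  set Zt : Set (BondConfig (Fin n)) := openConnIn S o z with hZt
  set f : Set (BondConfig (Fin n)) := (openConn z b)ᶜ ∩ openConn y b with hf
  set D : Set (BondConfig (Fin n)) := (openConn y z)ᶜ with hD
  -- `f ⊆ D`
  have hfD : f ⊆ D := by
    rintro ω ⟨h1, h2⟩ h3
    exact h1 (SimpleGraph.Reachable.trans (SimpleGraph.Reachable.symm h3) h2)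
  have hsplit : ∀ A B : Set (BondConfig (Fin n)), μ.real (A ∩ Bᶜ) = μ.real A - μ.real (B ∩ A) := by
    intro A B
    have h := measureReal_inter_add_sdiff (μ := μ) (s := A) (t := B) (hm B)
    rw [Set.sdiff_eq_compl_inter, Set.inter_comm Bᶜ A, Set.inter_comm A B] at h
    linarith
  rw [Set.inter_eq_right.2 hfD, Set.inter_eq_right.2 (Set.inter_subset_left.trans hfD),
    hsplit D Zt, hsplit f Zt] at key
  -- `key : μ f * (μ D - μ (Zt ∩ D)) ≤ μ D * (μ f - μ (Zt ∩ f))`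
  have hfle : μ.real f ≤ μ.real D := measureReal_mono hfD
  have hZf : μ.real (Zt ∩ f) ≤ μ.real f := measureReal_mono Set.inter_subset_right
  rcases (measureReal_nonneg (μ := μ) (s := D)).eq_or_lt with hD0 | hDpos
  · calc μ.real (Zt ∩ f) ≤ μ.real f := hZf
      _ ≤ μ.real D := hfle
      _ = 0 := hD0.symm
      _ ≤ μ.real Zt * μ.real f := mul_nonneg measureReal_nonneg measureReal_nonneg
  · have h2 : μ.real f * μ.real (Zt ∩ D) ≤ μ.real f * (μ.real Zt * μ.real D) :=
      mul_le_mul_of_nonneg_left hharris measureReal_nonneg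
    have h1 : μ.real D * μ.real (Zt ∩ f) ≤ μ.real D * (μ.real Zt * μ.real f) := by
      nlinarith [key, h2]
    exact le_of_mul_le_mul_left h1 hDpos

end Summit.CriticalPhenomena.PercolationContinuityZ3.Theorems
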